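import Summits.SmoothPoincare4.SmoothPoincare4.Theorems.SullivanDualTargetStubLiouvilleCollarStar
import Summits.SmoothPoincare4.SmoothPoincare4.Theorems.SullivanDualTargetStubLiouvilleCollarFlowOut
import Summits.SmoothPoincare4.SmoothPoincare4.Theorems.SullivanDualTargetStubLiouvilleCollarForms
import Summits.SmoothPoincare4.SmoothPoincare4.Theorems.SullivanDualTargetStubLiouvilleCollarField
import Literature.Geometry.Symplectic.GromovR4StdModel
import Literature.Geometry.Manifold.LocalDiffeoOnOpen
import Literature.Geometry.Manifold.InjOnLocalDiffeomorphInverse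

/-!
# The Liouville collar lemma in `ℝ⁴` (Geiges 2008, Lemma 5.2.4)

Helper file of stub `stub_liouvilleCollar` (line `kaehler-jacket`, crux stmt-SmoothPoincare4-7823):
the chart-level statement.  On a shell `W = {|‖y − c‖ − μ| < δ}` of `ℝ⁴` let `F` be a smooth
immersion into `(ℝ⁴, ω₀)`, `a` a smooth `1`-form with `da = F^*ω₀` (PRIM), `Z` its `ω_F`-dual
(Liouville) field (DUAL), pointing out of the round sphere `S_μ(c)` (OUT), and suppose that on
vectors tangent to `S_μ(c)` the form `a` is `e^{u(θ)} α₀` through `θ = A⁻¹(μ⁻¹(y − c))` (TEXT;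
`α₀ = ½ ω₀(θ, ·)`).  Then (`helper_kjEuclideanCollar`) there are `Ψ : ℝ⁴ → ℝ⁴` and `δ₁ > 0` such
that on the shell `{|‖y − c‖ − μ| < δ₁}`: `Ψ` is smooth with injective differential and injective,
`Ψ^*ω₀ = F^*ω₀`, `Ψ(y) = e^{u(θ)/2} θ` on `S_μ(c)`, and `‖y − c‖ < μ ⟺ Ψ y` lies inside the
star-shaped hypersurface `{e^{u(θ)/2} θ}`.

Construction (Geiges 2008, proof of Lemma 5.2.4): `Ψ = G ∘ Λ⁻¹` with `G z = e^{u(z/‖z‖)/2} z`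
(`…CollarStar`) and `Λ z = θ(2 log ‖z‖, c + μ A(z/‖z‖))` the flow box of the cut-off Liouville flow
`θ` (`…CollarField`, `…CollarFlowOut`), inverted on a logarithmic shell by the inverse function
theorem (`contDiffOn_invFunOn_of_forall_hasStrictFDerivAt_equiv`); `Ψ^*ω₀ = F^*ω₀` is
`G^*ω₀ = (F ∘ Λ)^*ω₀` (`…CollarForms`) transported through `DΛ`.

## References

* H. Geiges, *An Introduction to Contact Topology*, CUP 2008, Lemma 5.2.4. [Geiges2008]
-/

noncomputable section

set_option linter.dupNamespace false

open scoped Manifold ContDiff Topology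
open Set Function Metric
open Literature.Geometry.Symplectic (stdSymplecticForm stdSymplecticBilin stdSymplecticBilin_apply
  stdSymplecticForm_self)

namespace Summit.SmoothPoincare4.SmoothPoincare4.Theorems.Target.KaehlerJacket

/-- Model space `ℝ⁴ = ℂ²`. -/
local notation "E4" => EuclideanSpace ℝ (Fin 4)

/-- **The Liouville collar lemma, chart level** (`helper_kjEuclideanCollar`; Geiges 2008,
Lemma 5.2.4 with the computation `(θ ↦ ρθ)^*λ₀ = ρ² α₀`).  See the module docstring for the
statement; hypotheses in order: radii, smoothness of `u`, smoothness/immersivity of `F` and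
smoothness of `a` on the shell, (PRIM) `da = F^*ω₀`, (DUAL) `Z` is the `ω_F`-dual of `a`,
(OUT) `Z` points out of `S_μ(c)`, (TEXT) `a|_{TS_μ(c)} = e^{u} α₀` through
`θ = A⁻¹(μ⁻¹(y − c))`. [cite: Geiges2008, Lemma 5.2.4] -/
theorem helper_kjEuclideanCollar :
    ∀ (c : E4) (μ δ : ℝ) (F : E4 → E4) (a : E4 → E4 →L[ℝ] ℝ) (Z : E4 → E4) (A : E4 ≃ₗᵢ[ℝ] E4)
      (u : E4 → ℝ), 0 < μ → 0 < δ → δ ≤ μ → ContDiff ℝ ∞ u →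
      (∀ y : E4, |‖y - c‖ - μ| < δ →
        ContDiffAt ℝ ∞ F y ∧ Injective (fderiv ℝ F y) ∧ ContDiffAt ℝ ∞ a y) →
      (∀ y : E4, |‖y - c‖ - μ| < δ → ∀ v w : E4, fderiv ℝ a y v w - fderiv ℝ a y w v =
        stdSymplecticForm (fderiv ℝ F y v) (fderiv ℝ F y w)) →
      (∀ y : E4, |‖y - c‖ - μ| < δ → ∀ w : E4,
        stdSymplecticForm (fderiv ℝ F y (Z y)) (fderiv ℝ F y w) = a y w) →
      (∀ y : E4, ‖y - c‖ = μ → 0 < inner ℝ (Z y) (y - c)) →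
      (∀ y : E4, ‖y - c‖ = μ → ∀ w : E4, inner ℝ w (y - c) = 0 →
        a y w = Real.exp (u (A.symm (μ⁻¹ • (y - c)))) *
          (1 / 2 * stdSymplecticForm (A.symm (μ⁻¹ • (y - c))) (A.symm (μ⁻¹ • w)))) →
      ∃ (Ψ : E4 → E4) (δ₁ : ℝ), 0 < δ₁ ∧ δ₁ ≤ δ ∧
        (∀ y : E4, |‖y - c‖ - μ| < δ₁ → ContDiffAt ℝ ∞ Ψ y ∧ Injective (fderiv ℝ Ψ y)) ∧
        (∀ y y' : E4, |‖y - c‖ - μ| < δ₁ → |‖y' - c‖ - μ| < δ₁ → Ψ y = Ψ y' → y = y') ∧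
        (∀ y : E4, |‖y - c‖ - μ| < δ₁ → ∀ v w : E4,
          stdSymplecticForm (fderiv ℝ Ψ y v) (fderiv ℝ Ψ y w) =
            stdSymplecticForm (fderiv ℝ F y v) (fderiv ℝ F y w)) ∧
        (∀ y : E4, ‖y - c‖ = μ →
          Ψ y = Real.exp (u (A.symm (μ⁻¹ • (y - c))) / 2) • A.symm (μ⁻¹ • (y - c))) ∧
        (∀ y : E4, |‖y - c‖ - μ| < δ₁ →
          (‖y - c‖ < μ ↔ ‖Ψ y‖ < Real.exp (u (‖Ψ y‖⁻¹ • Ψ y) / 2))) := by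
  intro c μ δ F a Z A u hμ hδ hδμ hu hFa hprim hdual hout htext
  -- the cut-off Liouville flow
  obtain ⟨V, θ, δ', hδ', hδ'δ, hV, hθ, hθ0, hflow, hVZ⟩ :=
    helper_kjLiouvilleFlow c μ δ F a Z hμ hδ hδμ hFa hdual
  -- the star map
  set G : E4 → E4 := fun z => Real.exp (u (‖z‖⁻¹ • z) / 2) • z with hG_def
  have hGdef : ∀ z, G z = Real.exp (u (‖z‖⁻¹ • z) / 2) • z := fun z => rfl
  obtain ⟨hGs, hGself, hGsph, hGinj, hGDinj, hGnorm⟩ := helper_kjStarMap u G hu hGdef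
  -- the flow box
  set U : Set E4 := {y : E4 | |‖y - c‖ - μ| < δ'} with hU_def
  have hUopen : IsOpen U :=
    isOpen_lt ((continuous_id.sub continuous_const).norm.sub continuous_const).abs continuous_const
  have hSU : sphere c μ ⊆ U := fun y hy => by
    show |‖y - c‖ - μ| < δ'
    rw [mem_sphere_iff_norm.1 hy, sub_self, abs_zero]; exact hδ'
  have hUδ : ∀ y ∈ U, |‖y - c‖ - μ| < δ := fun y hy => lt_of_lt_of_le hy hδ'δ
  have houtV : ∀ y : E4, ‖y - c‖ = μ → 0 < inner ℝ (V y) (y - c) := fun y hy => by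
    rw [hVZ y (by rw [hy, sub_self, abs_zero]; exact hδ')]; exact hout y hy
  set Λ : E4 → E4 := fun z => θ (2 * Real.log ‖z‖, c + μ • A (‖z‖⁻¹ • z)) with hΛ_def
  have hΛdef : ∀ z, Λ z = θ (2 * Real.log ‖z‖, c + μ • A (‖z‖⁻¹ • z)) := fun z => rfl
  obtain ⟨ε, δ₁, hε, hδ₁, hbox, hinjO, hopen, hshell, hΛsph⟩ :=
    helper_kjFlowOut θ V c μ A U Λ hθ hV hθ0 hflow hμ hUopen hSU houtV hΛdef
  set O : Set E4 := {z : E4 | Real.exp (-ε) < ‖z‖ ∧ ‖z‖ < Real.exp ε} with hO_def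
  have hOopen : IsOpen O := isOpen_Ioo.preimage continuous_norm
  have hO0 : ∀ z ∈ O, z ≠ 0 := fun z hz =>
    norm_ne_zero_iff.1 (lt_trans (Real.exp_pos _) hz.1).ne'
  -- `G^*ω₀ = (F ∘ Λ)^*ω₀` on `O`
  have hforms := helper_kjCollarForms ε μ c A u G Λ F V a hε hμ
    (fun z hz => ⟨hGs z hz, hGself z hz⟩) hGsph
    (fun z h1 h2 => by
      obtain ⟨hΛs, -, hΛU, hself, -⟩ := hbox z h1 h2
      obtain ⟨hF1, -, ha1⟩ := hFa _ (hUδ _ hΛU)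
      refine ⟨hΛs, hself, hF1, ha1, fun w => ?_, hprim _ (hUδ _ hΛU)⟩
      rw [hVZ _ hΛU]; exact hdual _ (hUδ _ hΛU) w)
    hΛsph
    (fun z hz w hw => by
      have hy : ‖c + μ • A z - c‖ = μ := by
        rw [add_sub_cancel_left, norm_smul, Real.norm_of_nonneg hμ.le, A.norm_map, hz, mul_one]
      have hw' : inner ℝ (μ • A w) (c + μ • A z - c) = 0 := by
        rw [add_sub_cancel_left, real_inner_smul_left, real_inner_smul_right, A.inner_map_map, hw,
          mul_zero, mul_zero]
      rw [htext _ hy _ hw', add_sub_cancel_left, smul_smul, smul_smul, inv_mul_cancel₀ hμ.ne',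
        one_smul, one_smul, A.symm_apply_apply, A.symm_apply_apply])
  -- the inverse of the flow box
  set Λi : E4 → E4 := invFunOn Λ O with hΛi_def
  have hΛi : ∀ y ∈ Λ '' O, Λi y ∈ O ∧ Λ (Λi y) = y := fun y hy =>
    invFunOn_pos (by obtain ⟨z, hz, rfl⟩ := hy; exact ⟨z, hz, rfl⟩)
  have hequiv : ∀ z ∈ O, ∃ e : E4 ≃L[ℝ] E4, (e : E4 →L[ℝ] E4) = fderiv ℝ Λ z := by
    intro z hz
    obtain ⟨-, hinj, -⟩ := hbox z hz.1 hz.2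
    have hbij : Bijective (fderiv ℝ Λ z) :=
      ⟨hinj, (LinearMap.injective_iff_surjective (f := (fderiv ℝ Λ z : E4 →ₗ[ℝ] E4))).1 hinj⟩
    exact ⟨Literature.Geometry.Manifold.continuousLinearEquivOfBijective _ hbij,
      Literature.Geometry.Manifold.coe_continuousLinearEquivOfBijective _ hbij⟩
  have hΛi_smooth : ContDiffOn ℝ ∞ Λi (Λ '' O) := by
    refine Literature.Geometry.Manifold.contDiffOn_invFunOn_of_forall_hasStrictFDerivAt_equiv
      hOopen (fun z hz => (hbox z hz.1 hz.2).1.contDiffWithinAt) (by simp) hinjO fun z hz => ?_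
    obtain ⟨e, he⟩ := hequiv z hz
    exact ⟨e, by rw [he]; exact (hbox z hz.1 hz.2).1.hasStrictFDerivAt (by simp)⟩
  -- the collar map
  set Ψ : E4 → E4 := G ∘ Λi with hΨ_def
  have hshell' : ∀ y : E4, |‖y - c‖ - μ| < min δ₁ δ' → y ∈ Λ '' O := fun y hy =>
    hshell y (lt_of_lt_of_le hy (min_le_left _ _))
  -- derivative bookkeeping at a point of the image
  have hderiv : ∀ y ∈ Λ '' O, ContDiffAt ℝ ∞ Ψ y ∧
      fderiv ℝ Ψ y = (fderiv ℝ G (Λi y)).comp (fderiv ℝ Λi y) ∧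
      (fderiv ℝ Λ (Λi y)).comp (fderiv ℝ Λi y) = ContinuousLinearMap.id ℝ E4 := by
    intro y hy
    obtain ⟨hzO, hΛz⟩ := hΛi y hy
    have hΛis : ContDiffAt ℝ ∞ Λi y := hΛi_smooth.contDiffAt (hopen.mem_nhds hy)
    have hGz : ContDiffAt ℝ ∞ G (Λi y) := hGs _ (hO0 _ hzO)
    have hΨs : ContDiffAt ℝ ∞ Ψ y := hGz.comp y hΛis
    refine ⟨hΨs, fderiv_comp y (hGz.differentiableAt (by simp)) (hΛis.differentiableAt (by simp)),
      ?_⟩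
    have hΛd : DifferentiableAt ℝ Λ (Λi y) := (hbox _ hzO.1 hzO.2).1.differentiableAt (by simp)
    rw [← fderiv_comp y hΛd (hΛis.differentiableAt (by simp))]
    have hev : Λ ∘ Λi =ᶠ[𝓝 y] id := by
      filter_upwards [hopen.mem_nhds hy] with y' hy'
      exact (hΛi y' hy').2
    rw [hev.fderiv_eq, fderiv_id]
  refine ⟨Ψ, min δ₁ δ', lt_min hδ₁ hδ', (min_le_right _ _).trans hδ'δ, ?_, ?_, ?_, ?_, ?_⟩
  · -- embedding of the shell
    intro y hy
    obtain ⟨hΨs, hDΨ, hid⟩ := hderiv y (hshell' y hy)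
    refine ⟨hΨs, ?_⟩
    rw [hDΨ]
    have hinjΛi : Injective (fderiv ℝ Λi y) := by
      intro v w h
      have := congrArg (fderiv ℝ Λ (Λi y)) h
      rwa [← ContinuousLinearMap.comp_apply, ← ContinuousLinearMap.comp_apply, hid] at this
    exact (hGDinj _ (hO0 _ (hΛi y (hshell' y hy)).1)).comp hinjΛi
  · -- injectivity
    intro y y' hy hy' h
    obtain ⟨hz, hΛz⟩ := hΛi y (hshell' y hy)
    obtain ⟨hz', hΛz'⟩ := hΛi y' (hshell' y' hy')
    have hzz : Λi y = Λi y' := hGinj _ _ (hO0 _ hz) (hO0 _ hz') h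
    rw [← hΛz, ← hΛz', hzz]
  · -- `Ψ^*ω₀ = F^*ω₀`
    intro y hy v w
    obtain ⟨-, hDΨ, hid⟩ := hderiv y (hshell' y hy)
    obtain ⟨hz, hΛz⟩ := hΛi y (hshell' y hy)
    have hv : v = fderiv ℝ Λ (Λi y) (fderiv ℝ Λi y v) := by
      rw [← ContinuousLinearMap.comp_apply, hid]; rfl
    have hw : w = fderiv ℝ Λ (Λi y) (fderiv ℝ Λi y w) := by
      rw [← ContinuousLinearMap.comp_apply, hid]; rfl
    rw [hDΨ, ContinuousLinearMap.comp_apply, ContinuousLinearMap.comp_apply,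
      hforms _ hz.1 hz.2, hΛz]
    conv_rhs => rw [hv, hw]
  · -- the star-shaped model on the sphere
    intro y hy
    set w : E4 := A.symm (μ⁻¹ • (y - c)) with hw
    have hw1 : ‖w‖ = 1 := by
      rw [hw, A.symm.norm_map, norm_smul, norm_inv, Real.norm_of_nonneg hμ.le, hy,
        inv_mul_cancel₀ hμ.ne']
    have hwO : w ∈ O :=
      ⟨by rw [hw1]; exact Real.exp_lt_one_iff.2 (by linarith),
        by rw [hw1]; exact Real.one_lt_exp_iff.2 hε⟩
    have hΛw : Λ w = y := by
      rw [(hΛsph w hw1).1, hw, A.apply_symm_apply, smul_smul, mul_inv_cancel₀ hμ.ne', one_smul,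
        add_sub_cancel]
    have hΛiy : Λi y = w := by
      rw [← hΛw]
      exact hinjO.leftInvOn_invFunOn hwO
    show G (Λi y) = _
    rw [hΛiy, hGdef, hw1, inv_one, one_smul]
  · -- sides
    intro y hy
    obtain ⟨hz, hΛz⟩ := hΛi y (hshell' y hy)
    obtain ⟨-, -, -, -, hside⟩ := hbox _ hz.1 hz.2
    show _ ↔ ‖G (Λi y)‖ < Real.exp (u (‖G (Λi y)‖⁻¹ • G (Λi y)) / 2)
    rw [(hGnorm _).2, (hGnorm _).1, mul_lt_iff_lt_one_right (Real.exp_pos _), ← hside, hΛz]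

end Summit.SmoothPoincare4.SmoothPoincare4.Theorems.Target.KaehlerJacket

end
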